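import Summits.PneNP.PneNP.Theorems.ChebyshevTracialDesignSmallBlockMaskAverage
import HarnessLib

/-!
# Cell pnp-psdrank, route `ChebyshevTracialDesign`: SMALL AND INTERMEDIATE BLOCKS — THE M-AVERAGE WITH A LOWER CUT-OFF ON THE
# NUMBER OF INTERNAL EDGES (brick T-K4b; crux `TracialDecayExp20`, stmt-PneNP-19878)

Brick (T-K4b) (engine seat g24; eng MEMO-23 §3). Brick (T-K4) (`ChebyshevTracialDesignSmallBlockMaskAverage`) averages the per-matching
pricing of brick (T-K3) over all matchings, charging the matchings with more than `a₀` edges inside the block `H` (`|H| = h`) to the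
`a`-tail `(h+1)·ρ^{a₀+1}` under the one-line hypothesis `(b+1)(b+2) ≤ ρ(h−b)(n−h−b)` for ALL `b < h` — which forces `ρ ≳ h²/n`, i.e.
`h ≲ √n`. For `√n ≲ h ≲ √(nD)` the typical number of internal edges is `≈ h²/2n ≥ 1` but still `≪ D`: asking the ratio hypothesis only
ABOVE a cut-off `a₁` (i.e. for `b + 2a₁ < h`, where `ρ = h(h+1)/((2a₁+1)(n−2h+2a₁+1)) ≲ h²/(a₁ n)` works) and climbing only
`a₀ + 1 − a₁` double steps gives the tail `(h+1)·ρ^{a₀+1−a₁}`: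

* §1 `avg_le_of_split` — the generic averaging step (good matchings `≤ B₁`, all `≤ B₂`, bad mass `≤ μ|PM|` ⟹ average `≤ B₁ + μB₂`);
  **`value_le_uniform`** — brick (T-K3) made uniform: every matching with at most `a₀` edges inside `H` has
  `|PM|·Σ_U W(U,M)ψ(|U∩H|) ≤ B_v·G·3^{a₀}·θ^{D−a₀+1}` once `((T−1)/2)·¼(h/R)²e^{3h/R} ≤ θ ≤ 1`.
* §2 `card_pmatch_internal_gt_le_cutoff` (the `a`-tail beyond the cut-off, from eng g20's `card_filter_cr_le_le` with
  `m = a₀+1−a₁`), `rho_hyp_cutoff` (the explicit `ρ`).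
* §3 **`smallBlock_designValue_avg_le_cutoff`**: `Σ_M Σ_U W(U,M)·ψ(|U∩H|) ≤ B_v·G·(3^{a₀}·θ^{D−a₀+1} + (h+1)·ρ^{a₀+1−a₁})`, and
  **`smallBlock_designValue_avg_le_cutoff'`** with `ρ = h(h+1)/((2a₁+1)(n−2h+2a₁+1))`.
READING (eng MEMO-23 §3): with `a₁ ≈ 5h²/n` and `a₀ ≈ D/2` the design value of the untilted `H`-symmetric class is super-polynomially
small for every block with `h ≲ √(nD)/5 ≍ n^{5/8}`, EFFECTIVELY. WHAT THIS FILE DOES NOT DO: `h` between `n^{5/8}` and `βn`;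
tilted masks; anything on `TracialDecayExp20` itself, psd rank of P_PM(K_n), or P vs NP.
[cite: Rothvoss2017, §2 (PDF pp. 5–6)] [cite: Agarwal2000DifferenceEquations, Remark 1.8.1 (1.8.8)]
Stature: support/instrument (kernel lane, no defs, axioms standard). Supports stmt-PneNP-19878.
-/

set_option linter.dupNamespace false -- `Summit.PneNP.PneNP.…`: summit = sub-problem (D-0017)

noncomputable section

namespace Summit.PneNP.PneNP.Theorems.ChebyshevTracialDesignSmallBlockMaskAverageCutoff

open Finset Literature.Barriers.PneNP Literature.Combinatorics.Optimization
open Literature.Combinatorics.Optimization.ShellStep Literature.Combinatorics.SimpleGraph.CycleSpace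
open Summit.PneNP.PneNP.Theorems.ChebyshevTracialDesignJunta
open Summit.PneNP.PneNP.Theorems.ChebyshevTracialDesignClosedPairCount (card_filter_pmatch)
open Summit.PneNP.PneNP.Theorems.ChebyshevTracialDesignCrossingCountTails (card_filter_cr_le_le)
open Summit.PneNP.PneNP.Theorems.ChebyshevTracialDesignCrossingCountTailsExplicit (card_filter_crosses_eq
  card_pmatch_eq_card_perfectMatchings)
open Summit.PneNP.PneNP.Theorems.ChebyshevTracialDesignCrossingPlaneAverage (card_reps_vB_eq_card_crosses)
open Summit.PneNP.PneNP.Theorems.ChebyshevTracialDesignBlockMaskAverage (blockMask_value_le_trivial)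
open Summit.PneNP.PneNP.Theorems.ChebyshevTracialDesignSmallBlockMaskPricingHH (smallBlockHH_designValue_le)
open Summit.PneNP.PneNP.Theorems.ChebyshevTracialDesignSmallBlockMaskAverage (choose_mul_pow_le_mul_pow qParam_mono)

variable {n : ℕ}

/-! ### §1 The generic averaging step and the uniform per-matching bound -/

/-- **Averaging over the matchings with a good/bad split.** If `V ≤ B₁` on the matchings satisfying `P`, `V ≤ B₂` everywhere
(`B₁, B₂ ≥ 0`), and the matchings violating `P` number at most `μ·|PMatch n|`, then `Σ_M |PM|⁻¹·V(M) ≤ B₁ + μ·B₂`.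
[cite: Rothvoss2017, §2 (PDF p. 6)] -/
theorem avg_le_of_split (P : PMatch n → Prop) [DecidablePred P] (V : PMatch n → ℝ) {B₁ B₂ μ : ℝ} (hB₁ : 0 ≤ B₁)
    (hB₂ : 0 ≤ B₂) (hμ : 0 ≤ μ) (hgood : ∀ M, P M → V M ≤ B₁) (hall : ∀ M, V M ≤ B₂)
    (hbad : (((univ.filter fun M : PMatch n => ¬ P M).card : ℕ) : ℝ) ≤ μ * (Fintype.card (PMatch n) : ℝ)) :
    ∑ M : PMatch n, (Fintype.card (PMatch n) : ℝ)⁻¹ * V M ≤ B₁ + μ * B₂ := by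
  classical
  rcases isEmpty_or_nonempty (PMatch n) with hE | ⟨⟨M₀⟩⟩
  · rw [Fintype.sum_empty]; positivity
  have hPM : (0 : ℝ) < Fintype.card (PMatch n) := by exact_mod_cast Fintype.card_pos_iff.2 ⟨M₀⟩
  rw [← mul_sum, ← sum_filter_add_sum_filter_not univ P]
  have h1 : ∑ M ∈ univ.filter P, V M ≤ ((univ.filter P).card : ℝ) * B₁ := by
    calc ∑ M ∈ univ.filter P, V M ≤ ∑ M ∈ univ.filter P, B₁ := sum_le_sum fun M hM => hgood M (mem_filter.1 hM).2
      _ = _ := by rw [sum_const, nsmul_eq_mul]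
  have h2 : ∑ M ∈ univ.filter (fun M => ¬ P M), V M ≤ ((univ.filter fun M => ¬ P M).card : ℝ) * B₂ := by
    calc ∑ M ∈ univ.filter (fun M => ¬ P M), V M ≤ ∑ M ∈ univ.filter (fun M => ¬ P M), B₂ :=
          sum_le_sum fun M _ => hall M
      _ = _ := by rw [sum_const, nsmul_eq_mul]
  have h3 : ((univ.filter P).card : ℝ) ≤ Fintype.card (PMatch n) := by exact_mod_cast card_filter_le _ _
  have htot : ∑ M ∈ univ.filter P, V M + ∑ M ∈ univ.filter (fun M => ¬ P M), V M ≤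
      (Fintype.card (PMatch n) : ℝ) * B₁ + μ * (Fintype.card (PMatch n) : ℝ) * B₂ := by
    have e1 := mul_le_mul_of_nonneg_right h3 hB₁
    have e2 := mul_le_mul_of_nonneg_right hbad hB₂
    linarith
  calc (Fintype.card (PMatch n) : ℝ)⁻¹ * (∑ M ∈ univ.filter P, V M + ∑ M ∈ univ.filter (fun M => ¬ P M), V M)
      ≤ (Fintype.card (PMatch n) : ℝ)⁻¹ * ((Fintype.card (PMatch n) : ℝ) * B₁ + μ * (Fintype.card (PMatch n) : ℝ) * B₂) :=
        mul_le_mul_of_nonneg_left htot (by positivity)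
    _ = B₁ + μ * B₂ := by field_simp

/-- **Brick (T-K3) made uniform in the number of internal edges.** For an exact design `(n,t,T,D,B_v,C,w)` (`n = 2N`, `t = 2s₀+1`), a
block `|H| = h`, `a₀ ≤ D`, `R ≥ 1` with `R + 3(D+1) + h + (T−1)/2 ≤ s₀+1`, `R + 3(D+1) + h + s₀ + (T−1)/2 + 1 ≤ N`,
`(h/R)²e^{3h/R} ≤ 2`, `((T−1)/2)·¼(h/R)²e^{3h/R} ≤ θ ≤ 1`, `0 ≤ ψ ≤ G`, and a matching `M` with at most `a₀` edges inside `H`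
(`h < cr(H,M) + 2(a₀+1)`): `|PM|·Σ_U W(U,M)·ψ(|U∩H|) ≤ B_v·G·3^{a₀}·θ^{D−a₀+1}`.
[cite: Rothvoss2017, §2 (PDF pp. 5–6)] [cite: Agarwal2000DifferenceEquations, Remark 1.8.1 (1.8.8)] -/
theorem value_le_uniform {t T D : ℕ} {Bv : ℝ} {C : Finset ℕ} {w : ℕ → ℝ}
    (hdes : IsExactDesign n t T D Bv C w) {N : ℕ} (hn : (univ : Finset (Fin n)).card = 2 * N)
    (H : Finset (Fin n)) {h s₀ a₀ R : ℕ} (hh : H.card = h) (ht : t = 2 * s₀ + 1) (ha₀ : a₀ ≤ D) (hR : 1 ≤ R)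
    (hR1 : R + 3 * (D + 1) + h + (T - 1) / 2 ≤ s₀ + 1) (hR2 : R + 3 * (D + 1) + h + s₀ + (T - 1) / 2 + 1 ≤ N)
    (hq : ((h : ℝ) / R) ^ 2 * Real.exp (3 * h / R) ≤ 2) {θ : ℝ}
    (hθ : ((((T - 1) / 2 : ℕ)) : ℝ) * ((1 / 4 : ℝ) * ((h : ℝ) / R) ^ 2 * Real.exp (3 * h / R)) ≤ θ) (hθ1 : θ ≤ 1)
    (ψ : ℤ → ℝ) {G : ℝ} (hG0 : 0 ≤ G) (hG : ∀ x ∈ Icc (0 : ℤ) (t : ℤ), |ψ x| ≤ G)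
    (hψ0 : ∀ x ∈ Icc (0 : ℤ) (t : ℤ), 0 ≤ ψ x) (M : PMatch n)
    (hM : H.card < (M.1.filter (Crosses H)).card + 2 * (a₀ + 1)) :
    (Fintype.card (PMatch n) : ℝ) * ∑ U : OddSet n, levelWeight n t C w U M * ψ ((U.1 ∩ H).card : ℤ) ≤
      Bv * G * ((3 : ℝ) ^ a₀ * θ ^ (D - a₀ + 1)) := by
  have hBv : 0 ≤ Bv := le_trans (sum_nonneg fun c _ => abs_nonneg _) hdes.2.2.2.2.2.2
  have hθ0 : 0 ≤ θ := le_trans (by positivity) hθ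
  set π := M.2.partner with hπdef
  have hπ : ∀ v, π (π v) = v := partner_partner M
  have hπ' : ∀ v, π v ≠ v := partner_ne M
  obtain ⟨a, ha⟩ : ∃ a, (reps π (vAA π univ H)).card = a := ⟨_, rfl⟩
  obtain ⟨b, hb⟩ : ∃ b, (reps π (vBH π univ H ∪ vBN π univ H)).card = b := ⟨_, rfl⟩
  have hab : h = 2 * a + b := by rw [← hh, card_eq_two_mul_add_of_types hπ hπ' H, ha, hb]
  have hbcr : b = (M.1.filter (Crosses H)).card := by rw [← hb, hπdef, card_reps_vB_eq_card_crosses M H]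
  have haa₀ : a ≤ a₀ := by rw [← hbcr, hh] at hM; omega
  have hbh : b ≤ h := by omega
  have hqb : ((b : ℝ) / R) ^ 2 * Real.exp (3 * b / R) ≤ 2 := by
    have h4 := qParam_mono (R := R) hbh
    linarith
  have hV := smallBlockHH_designValue_le hdes M hn H ha hb (D' := D - a) ht (by omega) hR (by omega) (by omega) hqb ψ hG hψ0
  set qb : ℝ := (1 / 4 : ℝ) * ((b : ℝ) / R) ^ 2 * Real.exp (3 * b / R) with hqbdef
  have hqb0 : 0 ≤ qb := by rw [hqbdef]; positivity
  have hJq : ((((T - 1) / 2 : ℕ)) : ℝ) * qb ≤ θ :=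
    le_trans (mul_le_mul_of_nonneg_left (qParam_mono (R := R) hbh) (by positivity)) hθ
  have hC : ((((T - 1) / 2).choose (D - a + 1) : ℕ) : ℝ) * qb ^ (D - a + 1) ≤ θ ^ (D - a₀ + 1) :=
    calc _ ≤ (((((T - 1) / 2 : ℕ)) : ℝ) * qb) ^ (D - a + 1) := choose_mul_pow_le_mul_pow _ _ hqb0
      _ ≤ θ ^ (D - a + 1) := pow_le_pow_left₀ (by positivity) hJq _
      _ ≤ θ ^ (D - a₀ + 1) := pow_le_pow_of_le_one hθ0 hθ1 (by omega)
  have h3 : (3 : ℝ) ^ a ≤ (3 : ℝ) ^ a₀ := pow_le_pow_right₀ (by norm_num) haa₀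
  calc _ ≤ Bv * ((((T - 1) / 2).choose (D - a + 1) : ℕ) : ℝ) * ((3 : ℝ) ^ a * (G * qb ^ (D - a + 1))) := hV
    _ = Bv * G * ((3 : ℝ) ^ a * (((((T - 1) / 2).choose (D - a + 1) : ℕ) : ℝ) * qb ^ (D - a + 1))) := by ring
    _ ≤ Bv * G * ((3 : ℝ) ^ a₀ * θ ^ (D - a₀ + 1)) :=
        mul_le_mul_of_nonneg_left (mul_le_mul h3 hC (by positivity) (by positivity)) (by positivity)

/-! ### §2 The `a`-tail beyond a lower cut-off -/

/-- **The `a`-tail beyond a lower cut-off.** If `a₁ ≤ a₀ + 1` and `(b+1)(b+2) ≤ ρ(h−b)(n−h−b)` for `b + 2a₁ < h` (`ρ ≥ 0`), then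
`#{M : cr(H,M) + 2(a₀+1) ≤ h} ≤ (h+1)·ρ^{a₀+1−a₁}·|PMatch n|` (`card_filter_cr_le_le` with `m = a₀+1−a₁` double steps from the threshold
`h − 2(a₀+1)`). [cite: Rothvoss2017, §2 (PDF p. 5)] -/
theorem card_pmatch_internal_gt_le_cutoff (H : Finset (Fin n)) {a₀ a₁ : ℕ} (ha₁ : a₁ ≤ a₀ + 1) {ρ : ℝ} (hρ0 : 0 ≤ ρ)
    (hρ : ∀ b : ℕ, b + 2 * a₁ < H.card →
      ((b : ℝ) + 1) * ((b : ℝ) + 2) ≤ ρ * (((H.card - b : ℕ) : ℝ) * (((n - H.card - b : ℕ)) : ℝ))) :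
    (((univ.filter fun M : PMatch n => (M.1.filter (Crosses H)).card + 2 * (a₀ + 1) ≤ H.card).card : ℕ) : ℝ) ≤
      ((H.card : ℝ) + 1) * ρ ^ (a₀ + 1 - a₁) * (Fintype.card (PMatch n) : ℝ) := by
  by_cases hsmall : H.card < 2 * (a₀ + 1)
  · have h0 : (univ.filter fun M : PMatch n => (M.1.filter (Crosses H)).card + 2 * (a₀ + 1) ≤ H.card) = ∅ :=
      filter_eq_empty_iff.2 fun M _ h => by omega
    rw [h0, card_empty, Nat.cast_zero]
    positivity
  have hsmall' : 2 * (a₀ + 1) ≤ H.card := not_lt.1 hsmall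
  have hc : (univ \ H).card = n - H.card := by rw [card_univ_sdiff, Fintype.card_fin]
  have h1 := card_filter_cr_le_le (subset_univ H) (ρ := ρ) (a₀ := H.card - 2 * (a₀ + 1)) (m := a₀ + 1 - a₁)
    (fun b hb => by rw [hc]; exact hρ b (by omega))
  have key : (univ.filter fun M : PMatch n => (M.1.filter (Crosses H)).card + 2 * (a₀ + 1) ≤ H.card).card =
      ((perfectMatchings (univ : Finset (Fin n))).filter fun M =>
        (M.filter fun e => cutCount H e = 1).card ≤ H.card - 2 * (a₀ + 1)).card := by
    rw [← card_filter_pmatch (fun M => (M.filter fun e => cutCount H e = 1).card ≤ H.card - 2 * (a₀ + 1))]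
    congr 1
    exact filter_congr fun M _ => by rw [card_filter_crosses_eq]; omega
  rw [key, card_pmatch_eq_card_perfectMatchings]
  refine h1.trans (mul_le_mul_of_nonneg_right (mul_le_mul_of_nonneg_right ?_ (pow_nonneg hρ0 _)) (by positivity))
  have : (((H.card - 2 * (a₀ + 1) : ℕ)) : ℝ) ≤ H.card := by exact_mod_cast Nat.sub_le _ _
  linarith

/-- **The tail hypothesis beyond the cut-off** holds with `ρ = h(h+1)/((2a₁+1)(n−2h+2a₁+1))` when `2h ≤ n`: for `b + 2a₁ < h`,
`(b+1)(b+2) ≤ ρ·(h−b)(n−h−b)`. [cite: Rothvoss2017, §2 (PDF p. 5)] -/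
theorem rho_hyp_cutoff {h a₁ : ℕ} (hn : 2 * h ≤ n) {b : ℕ} (hb : b + 2 * a₁ < h) :
    ((b : ℝ) + 1) * ((b : ℝ) + 2) ≤
      ((h : ℝ) * ((h : ℝ) + 1) / (((2 * a₁ + 1 : ℕ) : ℝ) * ((n - 2 * h + 2 * a₁ + 1 : ℕ) : ℝ))) *
        (((h - b : ℕ) : ℝ) * (((n - h - b : ℕ)) : ℝ)) := by
  have hd1 : (0 : ℝ) < ((2 * a₁ + 1 : ℕ) : ℝ) := by positivity
  have hd2 : (0 : ℝ) < ((n - 2 * h + 2 * a₁ + 1 : ℕ) : ℝ) := by positivity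
  have h1 : (((2 * a₁ + 1 : ℕ)) : ℝ) ≤ ((h - b : ℕ) : ℝ) := by exact_mod_cast (show 2 * a₁ + 1 ≤ h - b by omega)
  have h2 : (((n - 2 * h + 2 * a₁ + 1 : ℕ)) : ℝ) ≤ ((n - h - b : ℕ) : ℝ) := by
    exact_mod_cast (show n - 2 * h + 2 * a₁ + 1 ≤ n - h - b by omega)
  have hprod : (((2 * a₁ + 1 : ℕ)) : ℝ) * ((n - 2 * h + 2 * a₁ + 1 : ℕ) : ℝ) ≤ ((h - b : ℕ) : ℝ) * ((n - h - b : ℕ) : ℝ) :=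
    mul_le_mul h1 h2 hd2.le (by positivity)
  have hb1 : (b : ℝ) + 1 ≤ h := by exact_mod_cast (show b + 1 ≤ h by omega)
  calc ((b : ℝ) + 1) * ((b : ℝ) + 2) ≤ (h : ℝ) * ((h : ℝ) + 1) := by nlinarith
    _ = ((h : ℝ) * ((h : ℝ) + 1) / (((2 * a₁ + 1 : ℕ) : ℝ) * ((n - 2 * h + 2 * a₁ + 1 : ℕ) : ℝ))) *
          ((((2 * a₁ + 1 : ℕ)) : ℝ) * ((n - 2 * h + 2 * a₁ + 1 : ℕ) : ℝ)) := by field_simp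
    _ ≤ _ := mul_le_mul_of_nonneg_left hprod (by positivity)

/-! ### §3 The average with a lower cut-off -/

/-- **SMALL AND INTERMEDIATE BLOCKS: THE M-AVERAGE WITH A LOWER CUT-OFF (brick T-K4b).** For an exact design `(n,t,T,D,B_v,C,w)`
(`n = 2N`, `t = 2s₀+1`), a block `|H| = h`, cut-offs `a₁ ≤ a₀ + 1`, `a₀ ≤ D`, `R ≥ 1` with `R + 3(D+1) + h + (T−1)/2 ≤ s₀+1`,
`R + 3(D+1) + h + s₀ + (T−1)/2 + 1 ≤ N`, `(h/R)²e^{3h/R} ≤ 2`, `((T−1)/2)·¼(h/R)²e^{3h/R} ≤ θ ≤ 1`, `ρ ≥ 0` with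
`(b+1)(b+2) ≤ ρ(h−b)(n−h−b)` for `b + 2a₁ < h`, and `0 ≤ ψ ≤ G`:
`Σ_M Σ_U W(U,M)·ψ(|U∩H|) ≤ B_v·G·3^{a₀}·θ^{D−a₀+1} + (h+1)·ρ^{a₀+1−a₁}·(G·B_v)`.
[cite: Rothvoss2017, §2 (PDF pp. 5–6)] [cite: Agarwal2000DifferenceEquations, Remark 1.8.1 (1.8.8)] -/
theorem smallBlock_designValue_avg_le_cutoff {t T D : ℕ} {Bv : ℝ} {C : Finset ℕ} {w : ℕ → ℝ}
    (hdes : IsExactDesign n t T D Bv C w) {N : ℕ} (hn : (univ : Finset (Fin n)).card = 2 * N)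
    (H : Finset (Fin n)) {h s₀ a₀ a₁ R : ℕ} (hh : H.card = h) (ht : t = 2 * s₀ + 1) (ha₀ : a₀ ≤ D) (ha₁ : a₁ ≤ a₀ + 1)
    (hR : 1 ≤ R) (hR1 : R + 3 * (D + 1) + h + (T - 1) / 2 ≤ s₀ + 1) (hR2 : R + 3 * (D + 1) + h + s₀ + (T - 1) / 2 + 1 ≤ N)
    (hq : ((h : ℝ) / R) ^ 2 * Real.exp (3 * h / R) ≤ 2) {θ : ℝ}
    (hθ : ((((T - 1) / 2 : ℕ)) : ℝ) * ((1 / 4 : ℝ) * ((h : ℝ) / R) ^ 2 * Real.exp (3 * h / R)) ≤ θ) (hθ1 : θ ≤ 1)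
    {ρ : ℝ} (hρ0 : 0 ≤ ρ)
    (hρ : ∀ b : ℕ, b + 2 * a₁ < h → ((b : ℝ) + 1) * ((b : ℝ) + 2) ≤ ρ * (((h - b : ℕ) : ℝ) * (((n - h - b : ℕ)) : ℝ)))
    (ψ : ℤ → ℝ) {G : ℝ} (hG0 : 0 ≤ G) (hG : ∀ x ∈ Icc (0 : ℤ) (t : ℤ), |ψ x| ≤ G)
    (hψ0 : ∀ x ∈ Icc (0 : ℤ) (t : ℤ), 0 ≤ ψ x) :
    ∑ M : PMatch n, ∑ U : OddSet n, levelWeight n t C w U M * ψ ((U.1 ∩ H).card : ℤ) ≤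
      Bv * G * ((3 : ℝ) ^ a₀ * θ ^ (D - a₀ + 1)) + ((h : ℝ) + 1) * ρ ^ (a₀ + 1 - a₁) * (G * Bv) := by
  classical
  have hBv : 0 ≤ Bv := le_trans (sum_nonneg fun c _ => abs_nonneg _) hdes.2.2.2.2.2.2
  have hθ0 : 0 ≤ θ := le_trans (by positivity) hθ
  set V : PMatch n → ℝ := fun M => (Fintype.card (PMatch n) : ℝ) * ∑ U : OddSet n,
    levelWeight n t C w U M * ψ ((U.1 ∩ H).card : ℤ) with hVdef
  have hsumV : ∑ M : PMatch n, ∑ U : OddSet n, levelWeight n t C w U M * ψ ((U.1 ∩ H).card : ℤ) =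
      ∑ M : PMatch n, (Fintype.card (PMatch n) : ℝ)⁻¹ * V M := by
    refine sum_congr rfl fun M _ => ?_
    have hPM : (Fintype.card (PMatch n) : ℝ) ≠ 0 := by
      have : 0 < Fintype.card (PMatch n) := Fintype.card_pos_iff.2 ⟨M⟩
      positivity
    rw [hVdef]
    simp only []
    rw [← mul_assoc, inv_mul_cancel₀ hPM, one_mul]
  rw [hsumV]
  have hbad := card_pmatch_internal_gt_le_cutoff H (a₀ := a₀) ha₁ hρ0 (by rw [hh]; exact hρ)
  rw [hh] at hbad
  refine avg_le_of_split (fun M : PMatch n => H.card < (M.1.filter (Crosses H)).card + 2 * (a₀ + 1)) V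
    (by positivity) (by positivity) (by positivity)
    (fun M hM => value_le_uniform hdes hn H hh ht ha₀ hR hR1 hR2 hq hθ hθ1 ψ hG0 hG hψ0 M hM)
    (fun M => blockMask_value_le_trivial hdes M H ψ hG0 hG) ?_
  have e : (univ.filter fun M : PMatch n => ¬ (H.card < (M.1.filter (Crosses H)).card + 2 * (a₀ + 1))) =
      (univ.filter fun M : PMatch n => (M.1.filter (Crosses H)).card + 2 * (a₀ + 1) ≤ H.card) :=
    filter_congr fun M _ => by omega
  rw [e, hh]
  exact hbad

/-- **The same with the explicit `ρ = h(h+1)/((2a₁+1)(n−2h+2a₁+1))`** (`2h ≤ n`): for `h ≲ √(nD)` take `a₁ ≈ 5h²/n ≤ D/2 ≈ a₀`.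
[cite: Rothvoss2017, §2 (PDF pp. 5–6)] [cite: Agarwal2000DifferenceEquations, Remark 1.8.1 (1.8.8)] -/
theorem smallBlock_designValue_avg_le_cutoff' {t T D : ℕ} {Bv : ℝ} {C : Finset ℕ} {w : ℕ → ℝ}
    (hdes : IsExactDesign n t T D Bv C w) {N : ℕ} (hn : (univ : Finset (Fin n)).card = 2 * N)
    (H : Finset (Fin n)) {h s₀ a₀ a₁ R : ℕ} (hh : H.card = h) (h2h : 2 * h ≤ n) (ht : t = 2 * s₀ + 1) (ha₀ : a₀ ≤ D)
    (ha₁ : a₁ ≤ a₀ + 1) (hR : 1 ≤ R) (hR1 : R + 3 * (D + 1) + h + (T - 1) / 2 ≤ s₀ + 1)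
    (hR2 : R + 3 * (D + 1) + h + s₀ + (T - 1) / 2 + 1 ≤ N) (hq : ((h : ℝ) / R) ^ 2 * Real.exp (3 * h / R) ≤ 2) {θ : ℝ}
    (hθ : ((((T - 1) / 2 : ℕ)) : ℝ) * ((1 / 4 : ℝ) * ((h : ℝ) / R) ^ 2 * Real.exp (3 * h / R)) ≤ θ) (hθ1 : θ ≤ 1)
    (ψ : ℤ → ℝ) {G : ℝ} (hG0 : 0 ≤ G) (hG : ∀ x ∈ Icc (0 : ℤ) (t : ℤ), |ψ x| ≤ G)
    (hψ0 : ∀ x ∈ Icc (0 : ℤ) (t : ℤ), 0 ≤ ψ x) :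
    ∑ M : PMatch n, ∑ U : OddSet n, levelWeight n t C w U M * ψ ((U.1 ∩ H).card : ℤ) ≤
      Bv * G * ((3 : ℝ) ^ a₀ * θ ^ (D - a₀ + 1)) +
        ((h : ℝ) + 1) * ((h : ℝ) * ((h : ℝ) + 1) / (((2 * a₁ + 1 : ℕ) : ℝ) * ((n - 2 * h + 2 * a₁ + 1 : ℕ) : ℝ))) ^
          (a₀ + 1 - a₁) * (G * Bv) :=
  smallBlock_designValue_avg_le_cutoff hdes hn H hh ht ha₀ ha₁ hR hR1 hR2 hq hθ hθ1 (by positivity)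
    (fun b hb => rho_hyp_cutoff h2h hb) ψ hG0 hG hψ0

end Summit.PneNP.PneNP.Theorems.ChebyshevTracialDesignSmallBlockMaskAverageCutoff

end
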